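import Mathlib

/-!
# Two-element sets have unique products in torsion-free groups

An elementary pruning fact for non-unique-product searches [folklore]: in a torsion-free group,
if `A` is non-empty with `|A| ≤ 2` and `B` is non-empty and finite, then some product in `A · B` is
uniquely represented.  (For `A = {x, y}`: if no product `x b` were unique, `b ↦ y⁻¹ x b` would map
the finite set `B` into itself, forcing `y⁻¹ x` to have finite order.)  Consequently a
non-unique-product pair — in particular the support pair of a zero divisor, via
`Literature.Algebra.GroupRings.exists_nonUniqueProduct_pair_of_zero_divisor` — has both sides of
size at least `3`, so the cardinality clauses `|A| ≥ 3`, `|B| ≥ 3` are sound additions to a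
stage-U encoding on any torsion-free group.  Recorded for the `pub-kaplansky` search; compare the
classical facts on unique products and zero divisors recalled in [cite: Gardam2021, §1]
(Passman, *The algebraic structure of group rings*, Ch. 13), of which this is a small
combinatorial shadow.
-/

namespace Literature.Algebra.GroupRings

/-- A singleton always gives unique products. [folklore] -/
theorem uniqueMul_of_card_eq_one {G : Type*} [Group G] {A B : Finset G} (hA : A.card = 1)
    (hB : B.Nonempty) : ∃ a₀ ∈ A, ∃ b₀ ∈ B, UniqueMul A B a₀ b₀ := by
  obtain ⟨x, rfl⟩ := Finset.card_eq_one.mp hA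
  obtain ⟨b₀, hb₀⟩ := hB
  refine ⟨x, Finset.mem_singleton_self x, b₀, hb₀, ?_⟩
  intro a b ha _hb he
  have hax : a = x := Finset.mem_singleton.mp ha
  subst hax
  exact ⟨rfl, mul_left_cancel he⟩

/-- In a torsion-free group a two-element set `A` and any non-empty finite `B` have a uniquely
represented product. [folklore] -/
theorem uniqueMul_of_card_eq_two {G : Type*} [Group G] [DecidableEq G] [IsMulTorsionFree G]
    {A B : Finset G} (hA : A.card = 2) (hB : B.Nonempty) :
    ∃ a₀ ∈ A, ∃ b₀ ∈ B, UniqueMul A B a₀ b₀ := by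
  obtain ⟨x, y, hxy, rfl⟩ := Finset.card_eq_two.mp hA
  by_contra hno
  push Not at hno
  -- no product `x * b₀` is unique, so `y⁻¹ * x * b₀ ∈ B` for every `b₀ ∈ B`
  have hstep : ∀ b₀ ∈ B, y⁻¹ * x * b₀ ∈ B := by
    intro b₀ hb₀
    have h := hno x (by simp) b₀ hb₀
    unfold UniqueMul at h
    push Not at h
    obtain ⟨a, b, ha, hb, he, hne⟩ := h
    rcases Finset.mem_insert.mp ha with rfl | hay
    · exact absurd (mul_left_cancel he) (hne rfl)
    · have hay' : a = y := Finset.mem_singleton.mp hay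
      subst hay'
      have hb' : b = a⁻¹ * x * b₀ := by
        rw [mul_assoc, ← he, inv_mul_cancel_left]
      rw [← hb']; exact hb
  set c : G := y⁻¹ * x with hc
  have hc1 : c ≠ 1 := by
    intro h1
    apply hxy
    have : y⁻¹ * x = 1 := h1
    calc x = y * (y⁻¹ * x) := by group
      _ = y := by rw [this, mul_one]
  obtain ⟨b, hb⟩ := hB
  have hpow : ∀ n : ℕ, c ^ n * b ∈ B := by
    intro n
    induction n with
    | zero => simpa using hb
    | succ n ih =>
      have := hstep _ ih
      rw [pow_succ', mul_assoc]
      simpa [hc, mul_assoc] using this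
  have hinj : Function.Injective fun n : ℕ => c ^ n :=
    injective_pow_iff_not_isOfFinOrder.mpr (fun hfin => hc1 ((isOfFinOrder_iff_eq_one c).mp hfin))
  let f : ℕ → B := fun n => ⟨c ^ n * b, hpow n⟩
  have hf : Function.Injective f := by
    intro m n hmn
    have h1 : c ^ m * b = c ^ n * b := congrArg Subtype.val hmn
    exact hinj (mul_right_cancel h1)
  exact not_injective_infinite_finite f hf

/-- Hence a non-unique-product pair in a torsion-free group has `3 ≤ |A|` (and `3 ≤ |B|`:
`three_le_card_right_of_no_uniqueMul` below). [folklore] -/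
theorem three_le_card_of_no_uniqueMul {G : Type*} [Group G] [DecidableEq G] [IsMulTorsionFree G]
    {A B : Finset G} (hA : A.Nonempty) (hB : B.Nonempty)
    (h : ∀ a₀ ∈ A, ∀ b₀ ∈ B, ¬ UniqueMul A B a₀ b₀) : 3 ≤ A.card := by
  by_contra hlt
  push Not at hlt
  have hpos : 0 < A.card := Finset.card_pos.mpr hA
  interval_cases hcard : A.card
  · obtain ⟨a₀, ha₀, b₀, hb₀, hu⟩ := uniqueMul_of_card_eq_one hcard hB
    exact h a₀ ha₀ b₀ hb₀ hu
  · obtain ⟨a₀, ha₀, b₀, hb₀, hu⟩ := uniqueMul_of_card_eq_two hcard hB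
    exact h a₀ ha₀ b₀ hb₀ hu

open MulOpposite in
/-- Right-hand version of `three_le_card_of_no_uniqueMul`, via the opposite group: a
non-unique-product pair in a torsion-free group also has `3 ≤ |B|`. [folklore] -/
theorem three_le_card_right_of_no_uniqueMul {G : Type*} [Group G] [DecidableEq G]
    [IsMulTorsionFree G] {A B : Finset G} (hA : A.Nonempty) (hB : B.Nonempty)
    (h : ∀ a₀ ∈ A, ∀ b₀ ∈ B, ¬ UniqueMul A B a₀ b₀) : 3 ≤ B.card := by
  have h' : ∀ b' ∈ B.map ⟨_, op_injective⟩, ∀ a' ∈ A.map ⟨_, op_injective⟩,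
      ¬ UniqueMul (B.map ⟨_, op_injective⟩) (A.map ⟨_, op_injective⟩) b' a' := by
    intro b' hb' a' ha' hu
    obtain ⟨b₀, hb₀, rfl⟩ := Finset.mem_map.mp hb'
    obtain ⟨a₀, ha₀, rfl⟩ := Finset.mem_map.mp ha'
    exact h a₀ ha₀ b₀ hb₀ (UniqueMul.of_mulOpposite hu)
  have := three_le_card_of_no_uniqueMul (G := Gᵐᵒᵖ) (hB.map) (hA.map) h'
  simpa using this

end Literature.Algebra.GroupRings
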